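import Literature.NumberTheory.NumberFields.QuarticNormFormDyadicResidues
import Literature.NumberTheory.NumberFields.DyadicNonNormAtPrimeIdeal
import Literature.NumberTheory.IwasawaTheory.CyclotomicTwoLayerTwoNormForm
import Literature.NumberTheory.IwasawaTheory.ClassGroupPRankLeOneOfNonNormUnitLayerTwo
import HarnessLib

/-!
# A unit `ε ≢ ±1 (mod 𝔭₁⁴)` at a dyadic prime with `e = f = 1` is NOT a norm from the quartic cyclotomic layer `K_2 = K(θ)`, `θ⁴ − 4θ² + 2 = 0`;
# the PRO-CYCLIC DOOR with its unit hypothesis in base-field congruence currency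

Topic `NumberTheory/IwasawaTheory` (namespace = path).  THEOREM-ONLY file (no definition, no named fact, no instance, no `sorry`), written by the prover seat
`bsd-line-att-p3` g46 (cell `bsd-f1-sign2`, route `AlignedTransportAtTwo`; `--supports` stmt-BirchSwinnertonDyer-22298, closes nothing).  Sequel of
`NumberFields/QuarticNormFormDyadicResidues.lean` (this seat: `F(a,b,c,d) = 2^{4k}ε` forces `ε ≡ ±1 (mod 16)` in a `2`-adically digitised domain), of att-p3 g43's
`CyclotomicTwoLayerTwoNormForm.lean` (`N_{K(θ)/K}(a + bθ + cθ² + dθ³) = F(a,b,c,d)`) and of the tree's localisation package `DyadicNonNormAtPrimeIdeal.lean`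
(`exists_prime_uniformizer_localizationAtPrime`).  It discharges the displayed unit hypothesis «`ε ∉ N_{K_2/K} K_2ˣ`» of the PRO-CYCLIC DOOR
(`ClassGroupPRankLeOneOfNonNormUnitLayerTwo.lean`, this seat) from a CONGRUENCE in `𝓞_K`.

* ★★ `forall_normForm_ne_of_not_mem_pow_four` — `R` Dedekind, `𝔭 ≠ 0` maximal with `R/𝔭 = 𝔽₂` and `2 ∈ 𝔭 ∖ 𝔭²`, `ε ∈ Rˣ` with `ε − 1 ∉ 𝔭⁴`, `ε + 1 ∉ 𝔭⁴`:
  `F(x,y,z,w) ≠ ε` for all `x, y, z, w` in the fraction field (clear denominators; in `R_𝔭`, a DVR with uniformiser `~ 2`, absorb the unit part of the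
  denominator into the variables and apply the residue lemma; `16q = ϖ⁴·(…)` contradicts `ε ∓ 1 ∉ 𝔭⁴`).
* ★★ `unitsIncl_unitsMap_not_mem_map_norm_of_quartic_root` — `K` of odd degree, `L/K` Galois of degree `4` with `θ ∈ L`, `θ⁴ − 4θ² + 2 = 0`, `𝔭₁`, `ε` as above:
  `ε ∉ N_{L/K} Lˣ` in the tree's currency `unitsIncl K L ε ∉ (⊤ : Subgroup Lˣ).map (Herbrand.norm Gal(L/K))` (every `z ∈ L` is `a + bθ + cθ² + dθ³`, power basis).
* ★★★ `classGroupPRank_le_one_of_two_le_of_not_mem_pow_four_of_not_dvd_discr` — THE PRO-CYCLIC DOOR FROM BASE-FIELD DATA: `K` of odd degree with `2 ∤ d_K` and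
  EXACTLY two primes above `2`, `κ` cyclotomic, `2 ∤ h_K`, **`2 ≤ ord₂ h(K_1)`**, and a unit `ε` with **`ε ≢ ±1 (mod 𝔭₁⁴)`** at a dyadic prime `𝔭₁` of degree one ⟹
  `rank₂ Cl(K_m) ≤ 1 ∀ m`, `μ₂(κ) = 0`, `λ₂(κ) ≤ 1`.

«`ε ∉ N_{K_2/K}K_2ˣ` locally at `𝔭₁`» is the statement that `σ₁(ε) ∉ ±1 + 16ℤ₂`, the norm group of `ℚ₂(ζ₁₆)⁺/ℚ₂` on units (local class field theory); here only
the elementary direction is proved and used.  USE (cell bsd-f1-sign2, crux C2; complex cubic `F = ℚ(β)`, `Δ_W ≡ 5 (8)`, `2 = 𝔭₁𝔭₂`, `t` the exact `2`-adic depth of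
`ε_F`): the door's habitat `t = 3 ∧ e_1 ≥ 2` (e.g. `N = 12163`) now costs ONE congruence `ε_F ≢ ±1 (mod 𝔭₁⁴)` (i.e. `t ≤ 3`) and ONE class-number bit `4 ∣ h(F(√2))`.
HONEST SCOPE: elementary (norm forms, localisation, dyadic residues); nothing specific to any summit; BSD is not advanced by this file.

References: [NeukirchANT1999] Ch. I §11 (localisation at a prime is a DVR), Ch. V §1 (norm groups of `ℚ_p(ζ_{pⁿ})`); [Omeara1963] §63B; [Washington1997] §13.1
(`K_2 = K·ℚ(ζ₁₆)⁺`), §13.3 Prop. 13.22–13.23; [Lang1990] Ch. 13 §4 Lemma 4.1; [Fukuda1994] Thm. 1 (2).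
-/

set_option autoImplicit false

noncomputable section

open scoped NumberField nonZeroDivisors IntermediateField
open NumberField IsDedekindDomain Field Polynomial

namespace Literature.NumberTheory.IwasawaTheory

open Literature.NumberTheory.NumberFields Literature.NumberTheory.NumberFields.QuarticNormForm
  Literature.NumberTheory.NumberFields.AmbiguousClass Literature.NumberTheory.EllipticCurves
  Literature.NumberTheory.GaloisRepresentations Literature.NumberTheory.GaloisRepresentations.Herbrand
  Literature.NumberTheory.GaloisRepresentations.MinkowskiUnit Literature.NumberTheory.GaloisRepresentations.CyclicNormIndex

/-! ## §1 Dedekind domains: `F(x,y,z,w) ≠ ε` in the fraction field when `ε ≢ ±1 (mod 𝔭⁴)` -/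

section Dedekind

variable {R : Type*} [CommRing R]

/-- `F` is homogeneous of degree `4`. [folklore] -/
private theorem normForm_smul' (u a b c d : R) :
    (u * a) ^ 4 + 8 * (u * a) ^ 3 * (u * c) - 4 * (u * a) ^ 2 * (u * b) ^ 2 - 24 * (u * a) ^ 2 * (u * b) * (u * d) + 20 * (u * a) ^ 2 * (u * c) ^ 2 - 40 * (u * a) ^ 2 * (u * d) ^ 2
        - 8 * (u * a) * (u * b) ^ 2 * (u * c) - 32 * (u * a) * (u * b) * (u * c) * (u * d) + 16 * (u * a) * (u * c) ^ 3 - 48 * (u * a) * (u * c) * (u * d) ^ 2 + 2 * (u * b) ^ 4 + 16 * (u * b) ^ 3 * (u * d)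
        - 8 * (u * b) ^ 2 * (u * c) ^ 2 + 40 * (u * b) ^ 2 * (u * d) ^ 2 - 16 * (u * b) * (u * c) ^ 2 * (u * d) + 32 * (u * b) * (u * d) ^ 3 + 4 * (u * c) ^ 4 - 16 * (u * c) ^ 2 * (u * d) ^ 2
        + 8 * (u * d) ^ 4 =
      u ^ 4 * (a ^ 4 + 8 * a ^ 3 * c - 4 * a ^ 2 * b ^ 2 - 24 * a ^ 2 * b * d + 20 * a ^ 2 * c ^ 2 - 40 * a ^ 2 * d ^ 2
        - 8 * a * b ^ 2 * c - 32 * a * b * c * d + 16 * a * c ^ 3 - 48 * a * c * d ^ 2 + 2 * b ^ 4 + 16 * b ^ 3 * d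
        - 8 * b ^ 2 * c ^ 2 + 40 * b ^ 2 * d ^ 2 - 16 * b * c ^ 2 * d + 32 * b * d ^ 3 + 4 * c ^ 4 - 16 * c ^ 2 * d ^ 2
        + 8 * d ^ 4) := by
  ring

variable [IsDedekindDomain R] (P : Ideal R) [P.IsMaximal] (K : Type*) [Field K] [Algebra R K] [IsFractionRing R K]

/-- Clearing denominators: `F(x,y,z,w) = ε` in the fraction field gives `F(a,b,c,d) = t⁴ ε` in `R` with `t ≠ 0` (common denominator, homogeneity). [folklore] -/
private theorem exists_normForm_eq_pow_four_mul {ε : R} {x y z w : K}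
    (h : x ^ 4 + 8 * x ^ 3 * z - 4 * x ^ 2 * y ^ 2 - 24 * x ^ 2 * y * w + 20 * x ^ 2 * z ^ 2 - 40 * x ^ 2 * w ^ 2
        - 8 * x * y ^ 2 * z - 32 * x * y * z * w + 16 * x * z ^ 3 - 48 * x * z * w ^ 2 + 2 * y ^ 4 + 16 * y ^ 3 * w
        - 8 * y ^ 2 * z ^ 2 + 40 * y ^ 2 * w ^ 2 - 16 * y * z ^ 2 * w + 32 * y * w ^ 3 + 4 * z ^ 4 - 16 * z ^ 2 * w ^ 2
        + 8 * w ^ 4 = algebraMap R K ε) :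
    ∃ a b c d t : R, t ≠ 0 ∧ a ^ 4 + 8 * a ^ 3 * c - 4 * a ^ 2 * b ^ 2 - 24 * a ^ 2 * b * d + 20 * a ^ 2 * c ^ 2 - 40 * a ^ 2 * d ^ 2
        - 8 * a * b ^ 2 * c - 32 * a * b * c * d + 16 * a * c ^ 3 - 48 * a * c * d ^ 2 + 2 * b ^ 4 + 16 * b ^ 3 * d
        - 8 * b ^ 2 * c ^ 2 + 40 * b ^ 2 * d ^ 2 - 16 * b * c ^ 2 * d + 32 * b * d ^ 3 + 4 * c ^ 4 - 16 * c ^ 2 * d ^ 2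
        + 8 * d ^ 4 = t ^ 4 * ε := by
  obtain ⟨a₁, t₁, ht₁, hx⟩ := IsFractionRing.div_surjective (A := R) x
  obtain ⟨a₂, t₂, ht₂, hy⟩ := IsFractionRing.div_surjective (A := R) y
  obtain ⟨a₃, t₃, ht₃, hz⟩ := IsFractionRing.div_surjective (A := R) z
  obtain ⟨a₄, t₄, ht₄, hw⟩ := IsFractionRing.div_surjective (A := R) w
  have h1 : algebraMap R K t₁ ≠ 0 := IsFractionRing.to_map_ne_zero_of_mem_nonZeroDivisors ht₁
  have h2 : algebraMap R K t₂ ≠ 0 := IsFractionRing.to_map_ne_zero_of_mem_nonZeroDivisors ht₂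
  have h3 : algebraMap R K t₃ ≠ 0 := IsFractionRing.to_map_ne_zero_of_mem_nonZeroDivisors ht₃
  have h4 : algebraMap R K t₄ ≠ 0 := IsFractionRing.to_map_ne_zero_of_mem_nonZeroDivisors ht₄
  refine ⟨a₁ * t₂ * t₃ * t₄, a₂ * t₁ * t₃ * t₄, a₃ * t₁ * t₂ * t₄, a₄ * t₁ * t₂ * t₃, t₁ * t₂ * t₃ * t₄,
    mul_ne_zero (mul_ne_zero (mul_ne_zero (nonZeroDivisors.ne_zero ht₁) (nonZeroDivisors.ne_zero ht₂))
      (nonZeroDivisors.ne_zero ht₃)) (nonZeroDivisors.ne_zero ht₄), ?_⟩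
  have hx' : algebraMap R K a₁ = x * algebraMap R K t₁ := by rw [← hx, div_mul_cancel₀ _ h1]
  have hy' : algebraMap R K a₂ = y * algebraMap R K t₂ := by rw [← hy, div_mul_cancel₀ _ h2]
  have hz' : algebraMap R K a₃ = z * algebraMap R K t₃ := by rw [← hz, div_mul_cancel₀ _ h3]
  have hw' : algebraMap R K a₄ = w * algebraMap R K t₄ := by rw [← hw, div_mul_cancel₀ _ h4]
  apply IsFractionRing.injective R K
  simp only [map_add, map_sub, map_mul, map_pow, map_ofNat]
  rw [hx', hy', hz', hw', ← h]
  ring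

/-- ★★ **`F(x,y,z,w) ≠ ε` when `ε ≢ ±1 (mod 𝔭⁴)`**, at a dyadic prime IDEAL `𝔭` of a Dedekind domain `R` with `R/𝔭 = 𝔽₂` and `2 ∈ 𝔭 ∖ 𝔭²` (`e = f = 1`), for a unit `ε`
of `R` with `ε − 1 ∉ 𝔭⁴` and `ε + 1 ∉ 𝔭⁴` and all `x, y, z, w` in the fraction field: «`ε` is not a norm from `K(θ)`, `θ⁴ − 4θ² + 2 = 0`» in norm-form currency.
(In `R_𝔭`: `2 = ϖw`, `w` a unit, every element `2s` or `1 + 2s`; the denominator is `2ⁿ·unit`; `QuarticNormForm.exists_eq_of_normForm_eq_pow_mul`.)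
[cite: NeukirchANT1999, Ch. V §1 (norm group of `ℚ₂(ζ_{2ⁿ})`) and Ch. I §11] [cite: Omeara1963, §63B] -/
theorem forall_normForm_ne_of_not_mem_pow_four (hP0 : P ≠ ⊥) (hres : ∀ r : R, r ∈ P ∨ r - 1 ∈ P)
    (h2 : (2 : R) ∈ P) (h2' : (2 : R) ∉ P ^ 2) {ε : R} (hεu : IsUnit ε) (hε1 : ε - 1 ∉ P ^ 4) (hε2 : ε + 1 ∉ P ^ 4)
    (x y z w : K) :
    x ^ 4 + 8 * x ^ 3 * z - 4 * x ^ 2 * y ^ 2 - 24 * x ^ 2 * y * w + 20 * x ^ 2 * z ^ 2 - 40 * x ^ 2 * w ^ 2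
        - 8 * x * y ^ 2 * z - 32 * x * y * z * w + 16 * x * z ^ 3 - 48 * x * z * w ^ 2 + 2 * y ^ 4 + 16 * y ^ 3 * w
        - 8 * y ^ 2 * z ^ 2 + 40 * y ^ 2 * w ^ 2 - 16 * y * z ^ 2 * w + 32 * y * w ^ 3 + 4 * z ^ 4 - 16 * z ^ 2 * w ^ 2
        + 8 * w ^ 4 ≠ algebraMap R K ε := by
  classical
  intro h
  obtain ⟨a, b, c, d, t, ht, habcd⟩ := exists_normForm_eq_pow_four_mul K h
  -- the localisation `S = R_𝔭`
  haveI : IsDiscreteValuationRing (Localization.AtPrime P) :=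
    IsLocalization.AtPrime.isDiscreteValuationRing_of_dedekind_domain R hP0 _
  set S := Localization.AtPrime P with hS
  obtain ⟨ϖ, hϖ, hresS, hmem⟩ := exists_prime_uniformizer_localizationAtPrime P hP0 hres
  -- `2 = ϖ u` with `u` a unit
  obtain ⟨u, hu⟩ : ϖ ^ 1 ∣ algebraMap R S 2 := (hmem 2 1).mp (by rwa [pow_one])
  rw [pow_one, map_ofNat] at hu
  have hundvd : ¬ ϖ ∣ u := by
    rintro ⟨u', rfl⟩
    apply h2'
    rw [hmem, map_ofNat, hu]
    exact ⟨u', by ring⟩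
  have hmax : IsLocalRing.maximalIdeal S = Ideal.span {ϖ} := (IsDiscreteValuationRing.irreducible_iff_uniformizer ϖ).mp hϖ.irreducible
  have hunit : ∀ r : S, ¬ ϖ ∣ r → IsUnit r := by
    intro r hr
    by_contra hnu
    have hmemr : r ∈ IsLocalRing.maximalIdeal S := (IsLocalRing.mem_maximalIdeal r).mpr (mem_nonunits_iff.mpr hnu)
    rw [hmax, Ideal.mem_span_singleton] at hmemr
    exact hr hmemr
  obtain ⟨uu, huu⟩ := hunit u hundvd
  -- `S` is `2`-adically digitised, `2` a non-unit, `2 ≠ 0`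
  have hpar : ∀ r : S, ∃ s, r = 2 * s ∨ r = 1 + 2 * s := by
    intro r
    rcases hresS r with ⟨r', hr'⟩ | ⟨r', hr'⟩
    · refine ⟨↑uu⁻¹ * r', Or.inl ?_⟩
      rw [hu, ← huu, hr']
      rw [mul_assoc, ← mul_assoc (uu : S), Units.mul_inv, one_mul]
    · refine ⟨↑uu⁻¹ * r', Or.inr ?_⟩
      rw [hu, ← huu]
      rw [mul_assoc, ← mul_assoc (uu : S), Units.mul_inv, one_mul, ← hr']
      ring
  have h2S : ¬ IsUnit (2 : S) := by
    rw [hu]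
    exact fun hunit2 => hϖ.not_unit (isUnit_of_mul_isUnit_left hunit2)
  have h20 : (2 : S) ≠ 0 := by
    rw [hu, ← huu]; exact mul_ne_zero hϖ.ne_zero uu.ne_zero
  -- the unit `ε` and the equation in `S`
  have hεP : ε ∉ P := fun hεP => (Ideal.IsPrime.ne_top inferInstance) (Ideal.eq_top_of_isUnit_mem P hεP hεu)
  have hεS : IsUnit (algebraMap R S ε) := IsLocalization.map_units S (⟨ε, hεP⟩ : P.primeCompl)
  have hS_eq := congrArg (algebraMap R S) habcd
  simp only [map_add, map_sub, map_mul, map_pow, map_ofNat] at hS_eq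
  set aS := algebraMap R S a
  set bS := algebraMap R S b
  set cS := algebraMap R S c
  set dS := algebraMap R S d
  set tS := algebraMap R S t with htS
  set εS := algebraMap R S ε with hεSdef
  have htS0 : tS ≠ 0 := fun h0 =>
    ht (IsLocalization.injective S P.primeCompl_le_nonZeroDivisors (by rw [← htS, h0, map_zero]))
  -- `tS = 2ⁿ · v` with `v` a unit
  obtain ⟨n, v, hv⟩ := IsDiscreteValuationRing.associated_pow_irreducible htS0 hϖ.irreducible
  -- hv : tS * v = ϖ ^ n; `ϖ = 2 uu⁻¹`
  have hϖ2 : ϖ = 2 * ↑uu⁻¹ := by rw [hu, ← huu, mul_assoc, Units.mul_inv, mul_one]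
  have htv : tS = 2 ^ n * ↑(uu ^ n * v)⁻¹ := by
    have : tS = ϖ ^ n * ↑v⁻¹ := by rw [← hv, mul_assoc, Units.mul_inv, mul_one]
    rw [this, hϖ2, mul_pow, mul_inv, Units.val_mul, ← Units.val_pow_eq_pow_val, inv_pow, mul_assoc]
  set vv : Sˣ := (uu ^ n * v)⁻¹ with hvv
  -- divide the coordinates by `vv`
  have hmain : (↑vv⁻¹ * aS) ^ 4 + 8 * (↑vv⁻¹ * aS) ^ 3 * (↑vv⁻¹ * cS) - 4 * (↑vv⁻¹ * aS) ^ 2 * (↑vv⁻¹ * bS) ^ 2 - 24 * (↑vv⁻¹ * aS) ^ 2 * (↑vv⁻¹ * bS) * (↑vv⁻¹ * dS) + 20 * (↑vv⁻¹ * aS) ^ 2 * (↑vv⁻¹ * cS) ^ 2 - 40 * (↑vv⁻¹ * aS) ^ 2 * (↑vv⁻¹ * dS) ^ 2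
        - 8 * (↑vv⁻¹ * aS) * (↑vv⁻¹ * bS) ^ 2 * (↑vv⁻¹ * cS) - 32 * (↑vv⁻¹ * aS) * (↑vv⁻¹ * bS) * (↑vv⁻¹ * cS) * (↑vv⁻¹ * dS) + 16 * (↑vv⁻¹ * aS) * (↑vv⁻¹ * cS) ^ 3 - 48 * (↑vv⁻¹ * aS) * (↑vv⁻¹ * cS) * (↑vv⁻¹ * dS) ^ 2 + 2 * (↑vv⁻¹ * bS) ^ 4 + 16 * (↑vv⁻¹ * bS) ^ 3 * (↑vv⁻¹ * dS)
        - 8 * (↑vv⁻¹ * bS) ^ 2 * (↑vv⁻¹ * cS) ^ 2 + 40 * (↑vv⁻¹ * bS) ^ 2 * (↑vv⁻¹ * dS) ^ 2 - 16 * (↑vv⁻¹ * bS) * (↑vv⁻¹ * cS) ^ 2 * (↑vv⁻¹ * dS) + 32 * (↑vv⁻¹ * bS) * (↑vv⁻¹ * dS) ^ 3 + 4 * (↑vv⁻¹ * cS) ^ 4 - 16 * (↑vv⁻¹ * cS) ^ 2 * (↑vv⁻¹ * dS) ^ 2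
        + 8 * (↑vv⁻¹ * dS) ^ 4 = 2 ^ (4 * n) * εS := by
    rw [normForm_smul' (↑vv⁻¹ : S) aS bS cS dS, hS_eq, htv,
      show (↑vv⁻¹ : S) ^ 4 * (((2 : S) ^ n * ↑vv) ^ 4 * εS) = ((↑vv : S) * ↑vv⁻¹) ^ 4 * (2 ^ (4 * n) * εS) by ring,
      Units.mul_inv, one_pow, one_mul]
  obtain ⟨q, hq⟩ := exists_eq_of_normForm_eq_pow_mul h2S h20 hpar hεS n _ _ _ _ hmain
  -- `16 q = ϖ⁴ (u⁴ q)`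
  have h16 : (16 : S) * q = ϖ ^ 4 * (u ^ 4 * q) := by
    rw [show (16 : S) = 2 ^ 4 by norm_num, hu]; ring
  rcases hq with hq | hq
  · apply hε1
    rw [hmem, map_sub, map_one]
    exact ⟨u ^ 4 * q, by rw [← h16, ← hεSdef, hq]; ring⟩
  · apply hε2
    rw [hmem, map_add, map_one]
    exact ⟨u ^ 4 * q, by rw [← h16, ← hεSdef, hq]; ring⟩

end Dedekind

/-! ## §2 Number fields: `ε ∉ N_{L/K} Lˣ` for the quartic layer `L = K(θ)` -/

section NumberField

variable {K L : Type} [Field K] [NumberField K] [Field L] [NumberField L] [Algebra K L]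

/-- Every element of `L = K(θ)` (`[L:K] = 4`, `θ⁴ − 4θ² + 2 = 0`, `K` of odd degree) is `a + bθ + cθ² + dθ³` with `a, b, c, d ∈ K` (power basis of `K⟮θ⟯ = L`).
[cite: Washington1997, §13.1 (`K_2 = K(θ)`)] -/
theorem exists_eq_add_mul_quartic_root (hodd : Odd (Module.finrank ℚ K)) (hL : Module.finrank K L = 4) {θ : L} (hθ : θ ^ 4 - 4 * θ ^ 2 + 2 = 0)
    (z : L) : ∃ a b c d : K, z = algebraMap K L a + algebraMap K L b * θ + algebraMap K L c * θ ^ 2 + algebraMap K L d * θ ^ 3 := by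
  haveI : FiniteDimensional K L := Module.finite_of_finrank_eq_succ hL
  have hint : IsIntegral K θ := IsIntegral.of_finite K θ
  have htop : K⟮θ⟯ = ⊤ := by
    apply IntermediateField.eq_of_le_of_finrank_eq le_top
    rw [finrank_adjoin_quartic_root hodd θ hθ, IntermediateField.finrank_top', hL]
  set pb := IntermediateField.adjoin.powerBasis hint with hpb
  have hdim : pb.dim = 4 := by
    rw [hpb, IntermediateField.adjoin.powerBasis_dim, minpoly_eq_quartic_of_odd_finrank hodd θ hθ]
    compute_degree!
  have hz : z ∈ K⟮θ⟯ := by rw [htop]; exact IntermediateField.mem_top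
  obtain ⟨f, hf, hfz⟩ := pb.exists_eq_aeval ⟨z, hz⟩
  rw [hdim] at hf
  have hgen : ((pb.gen : K⟮θ⟯) : L) = θ := by rw [hpb, IntermediateField.adjoin.powerBasis_gen]; rfl
  have hzL : z = aeval θ f := by
    have h1 : z = ((aeval pb.gen f : K⟮θ⟯) : L) := congrArg Subtype.val hfz
    have h2 : ((aeval pb.gen f : K⟮θ⟯) : L) = aeval ((pb.gen : K⟮θ⟯) : L) f := by
      change (K⟮θ⟯.val) (aeval pb.gen f) = aeval (K⟮θ⟯.val pb.gen) f
      rw [Polynomial.aeval_algHom_apply]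
    rw [h1, h2, hgen]
  refine ⟨f.coeff 0, f.coeff 1, f.coeff 2, f.coeff 3, ?_⟩
  rw [hzL]
  conv_lhs => rw [f.as_sum_range' 4 hf, map_sum]
  simp only [Finset.sum_range_succ, Finset.sum_range_zero, zero_add, aeval_monomial, pow_zero, mul_one, pow_one]

/-- ★★ **A unit `ε ≢ ±1 (mod 𝔭₁⁴)` is not a norm from the quartic layer.**  `K` a number field of odd degree, `L/K` Galois of degree `4` containing `θ` with
`θ⁴ − 4θ² + 2 = 0` (a model of `K_2 = K·ℚ(ζ₁₆)⁺`); `𝔭₁` a maximal ideal of `𝓞_K` with `𝓞_K/𝔭₁ = 𝔽₂` and `2 ∈ 𝔭₁ ∖ 𝔭₁²`; `ε ∈ 𝓞_Kˣ` with `ε − 1 ∉ 𝔭₁⁴` and `ε + 1 ∉ 𝔭₁⁴`.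
THEN `ε ∉ N_{L/K} Lˣ` (tree currency: `unitsIncl K L ε ∉ (⊤ : Subgroup Lˣ).map (Herbrand.norm Gal(L/K))`): a norm would be `F(a,b,c,d) = ε` (att-p3 g43's norm form).
[cite: NeukirchANT1999, Ch. V §1 (norm group of `ℚ₂(ζ₁₆)`)] [cite: Omeara1963, §63B] [cite: Washington1997, §13.1] -/
theorem unitsIncl_unitsMap_not_mem_map_norm_of_quartic_root [IsGalois K L] (hodd : Odd (Module.finrank ℚ K))
    (hL : Module.finrank K L = 4) {θ : L} (hθ : θ ^ 4 - 4 * θ ^ 2 + 2 = 0)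
    (P : Ideal (𝓞 K)) [P.IsMaximal] (hP0 : P ≠ ⊥) (hres : ∀ r : 𝓞 K, r ∈ P ∨ r - 1 ∈ P)
    (h2 : (2 : 𝓞 K) ∈ P) (h2' : (2 : 𝓞 K) ∉ P ^ 2) (ε : (𝓞 K)ˣ) (hε1 : (ε : 𝓞 K) - 1 ∉ P ^ 4) (hε2 : (ε : 𝓞 K) + 1 ∉ P ^ 4) :
    unitsIncl K L (Units.map (algebraMap (𝓞 K) K : 𝓞 K →* K) ε) ∉
      (⊤ : Subgroup Lˣ).map (Herbrand.norm (L ≃ₐ[K] L)) := by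
  classical
  haveI : FiniteDimensional K L := Module.finite_of_finrank_eq_succ hL
  rintro ⟨zu, -, hzu⟩
  -- `N_{L/K}(z) = ε`
  have hnorm : algebraMap K L (Algebra.norm K (zu : L)) = algebraMap K L ((ε : 𝓞 K) : K) := by
    rw [Algebra.norm_eq_prod_automorphisms]
    have := congrArg (fun x : Lˣ => (x : L)) hzu
    simp only [Herbrand.norm_apply, Units.coe_prod, val_smul, Units.coe_map, MonoidHom.coe_coe] at this
    exact this
  have hnormK : Algebra.norm K (zu : L) = ((ε : 𝓞 K) : K) := (algebraMap K L).injective hnorm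
  obtain ⟨a, b, c, d, hz⟩ := exists_eq_add_mul_quartic_root hodd hL hθ (zu : L)
  rw [hz, Algebra.norm_quartic_layer_eq_normForm hodd hL hθ] at hnormK
  exact forall_normForm_ne_of_not_mem_pow_four P K hP0 hres h2 h2' ε.isUnit hε1 hε2 a b c d hnormK

end NumberField

/-! ## §3 The cyclotomic layer `K_2` and the pro-cyclic door from base-field data -/

section Layer

variable {K : Type} [Field K] [NumberField K]

/-- ★★ **`ε ≢ ±1 (mod 𝔭₁⁴)` ⟹ `ε ∉ N_{K_2/K} K_2ˣ`** for the second layer of a cyclotomic `ℤ₂`-extension of an odd-degree number field (`K_2 ∋ θ`, tree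
`exists_quartic_root_layer_two_of_not_dvd_finrank`). [cite: Washington1997, §13.1 (`K_2 = K·ℚ(ζ₁₆)⁺`)] [cite: NeukirchANT1999, Ch. V §1] -/
theorem unitsIncl_unitsMap_not_mem_map_norm_layer_two (hK : ¬ 2 ∣ Module.finrank ℚ K) (κ : ZpExtension K 2) (hκ : κ.IsCyclotomic)
    [NumberField (κ.layer 2)] (P : Ideal (𝓞 K)) [P.IsMaximal] (hP0 : P ≠ ⊥) (hres : ∀ r : 𝓞 K, r ∈ P ∨ r - 1 ∈ P)
    (h2 : (2 : 𝓞 K) ∈ P) (h2' : (2 : 𝓞 K) ∉ P ^ 2) (ε : (𝓞 K)ˣ) (hε1 : (ε : 𝓞 K) - 1 ∉ P ^ 4) (hε2 : (ε : 𝓞 K) + 1 ∉ P ^ 4) :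
    unitsIncl K (κ.layer 2) (Units.map (algebraMap (𝓞 K) K : 𝓞 K →* K) ε) ∉
      (⊤ : Subgroup (κ.layer 2)ˣ).map (Herbrand.norm ((κ.layer 2) ≃ₐ[K] (κ.layer 2))) := by
  haveI : IsGalois K (κ.layer 2) := κ.isGalois_layer_holds 2
  have hodd : Odd (Module.finrank ℚ K) := Nat.odd_iff.mpr (Nat.two_dvd_ne_zero.mp hK)
  have hL : Module.finrank K (κ.layer 2) = 4 := by rw [κ.finrank_layer_holds 2]; norm_num
  obtain ⟨θ, hθ⟩ := exists_quartic_root_layer_two_of_not_dvd_finrank hK κ hκ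
  exact unitsIncl_unitsMap_not_mem_map_norm_of_quartic_root hodd hL hθ P hP0 hres h2 h2' ε hε1 hε2

/-- ★★★ **THE PRO-CYCLIC DOOR FROM BASE-FIELD DATA.**  `K` a number field of odd degree with `2 ∤ d_K` and EXACTLY two primes above `2`, `κ` a cyclotomic
`ℤ₂`-extension, `2 ∤ h_K`, **`2 ≤ ord₂ h(K_1)`**, and a unit `ε ∈ 𝓞_Kˣ` with **`ε − 1 ∉ 𝔭₁⁴` and `ε + 1 ∉ 𝔭₁⁴`** at a maximal ideal `𝔭₁ ∋ 2` with `𝓞_K/𝔭₁ = 𝔽₂`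
(then `2 ∉ 𝔭₁²` as `2 ∤ d_K`).  THEN `rank₂ Cl(K_m) ≤ 1` for every `m`, `μ₂(κ) = 0` and `λ₂(κ) ≤ 1`.  (Cell reading: complex cubic `F = ℚ(β)`, `Δ_W ≡ 5 (8)`:
`t ≤ 3` and `e_1 ≥ 2`, which together force `t = 3`.) [cite: Washington1997, §13.3 Prop. 13.22–13.23] [cite: Lang1990, Ch. 13 §4 Lemma 4.1] [cite: Fukuda1994, Thm. 1 (2)]
[cite: NeukirchANT1999, Ch. V §1] -/
theorem classGroupPRank_le_one_of_two_le_of_not_mem_pow_four_of_not_dvd_discr (hK : ¬ 2 ∣ Module.finrank ℚ K)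
    (hd : ¬ (2 : ℤ) ∣ NumberField.discr K) (κ : ZpExtension K 2) (hκ : κ.IsCyclotomic)
    (h2card : {w : HeightOneSpectrum (𝓞 K) | ((2 : ℕ) : 𝓞 K) ∈ w.asIdeal}.ncard = 2)
    (hh : ¬ 2 ∣ classNumber K) (he1 : 2 ≤ classNumberPExp κ 1) [NumberField (κ.layer 2)]
    (P : Ideal (𝓞 K)) [P.IsMaximal] (hres : ∀ r : 𝓞 K, r ∈ P ∨ r - 1 ∈ P) (h2 : (2 : 𝓞 K) ∈ P) (h2' : (2 : 𝓞 K) ∉ P ^ 2)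
    (ε : (𝓞 K)ˣ) (hε1 : (ε : 𝓞 K) - 1 ∉ P ^ 4) (hε2 : (ε : 𝓞 K) + 1 ∉ P ^ 4) :
    (∀ m, classGroupPRank κ m ≤ 1) ∧ ClassicalMuVanishes κ ∧ classicalLambda κ ≤ 1 := by
  have hP0 : P ≠ ⊥ := fun h0 => by
    rw [h0, Ideal.mem_bot] at h2
    exact two_ne_zero h2
  exact classGroupPRank_le_one_of_two_le_of_not_mem_of_not_dvd_discr hK hd κ hκ h2card hh he1
    (unitsIncl_unitsMap_not_mem_map_norm_layer_two hK κ hκ P hP0 hres h2 h2' ε hε1 hε2)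

end Layer

end Literature.NumberTheory.IwasawaTheory

end
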